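import Mathlib
import HarnessLib

/-!
# BalabanIR engine `BirComplexStableXY` (stmt-HubbardSuperconductivity-2080): non-vanishing of
complex Gaussian integrals

Support lemmas for crux 2 of route BalabanIR (`--supports stmt-HubbardSuperconductivity-2080`),
companion of `BalabanIRBirComplexStableXYFixedVolumeLaplace.lean`.  The Laplace limit of the
fixed-volume partition function is `g 0 · ∫_{ℝ^ι} e^{−q}` with `q u = ½ Σ_{ij} Q_{ij} u_i u_j` a
complex quadratic form whose REAL PART is positive definite; to conclude `Z ≠ 0` for large `K`
one needs

  `∫_{ℝ^ι} exp (−½ Σ_{ij} Q_{ij} u_i u_j) du ≠ 0`      (`birGauss_integral_ne_zero`).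

Proof (no determinant formula needed): write `Q = A + iB` with `A, B` real symmetric, `A ≻ 0`.
By the spectral theorem (`Matrix.IsHermitian.spectral_theorem`, twice) there is a real matrix
`M` with `Mᵀ A M = 1` and `Mᵀ B M = diagonal d` (`birGauss_exists_congruence`); `det M ≠ 0`.
The linear change of variables `u = M w` (`Real.map_matrix_volume_pi_eq_smul_volume_pi`) turns
the integral into `|det M| ∏_i ∫_ℝ exp (−(1 + i d_i) w²/2) dw`, a product of one-dimensional
complex Gaussian integrals `(π / b_i)^{1/2}`, `Re b_i = 1/2` (`integral_gaussian_complex`), each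
non-zero.  No definitions.
-/

namespace Summit.HubbardSuperconductivity.HubbardSuperconductivity.Theorems

open scoped BigOperators Matrix
open MeasureTheory

section Gauss

variable {ι : Type*} [Fintype ι] [DecidableEq ι]

omit [DecidableEq ι] in
/-- Congruence bookkeeping: `(M w)ᵀ A (M w) = wᵀ (Mᵀ A M) w`. -/
theorem birGauss_form_congr (A M : Matrix ι ι ℝ) (w : ι → ℝ) :
    (M *ᵥ w) ⬝ᵥ (A *ᵥ (M *ᵥ w)) = w ⬝ᵥ ((Mᵀ * A * M) *ᵥ w) := by
  rw [Matrix.mulVec_mulVec, Matrix.dotProduct_mulVec, Matrix.dotProduct_mulVec,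
    ← Matrix.vecMul_transpose, Matrix.vecMul_vecMul, Matrix.mul_assoc]

/-- Over `ℝ`, a real unitary (orthogonal) matrix satisfies `Uᵀ U = 1`. -/
theorem birGauss_transpose_mul_self (U : Matrix.unitaryGroup ι ℝ) :
    (U : Matrix ι ι ℝ)ᵀ * (U : Matrix ι ι ℝ) = 1 := by
  have h := Unitary.coe_star_mul_self U
  rwa [Matrix.star_eq_conjTranspose, Matrix.conjTranspose_eq_transpose_of_trivial] at h

/-- Spectral theorem over `ℝ` in transpose form: `A = U (diagonal a) Uᵀ`. -/
theorem birGauss_spectral {A : Matrix ι ι ℝ} (hA : A.IsHermitian) :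
    A = (hA.eigenvectorUnitary : Matrix ι ι ℝ) * Matrix.diagonal hA.eigenvalues *
      (hA.eigenvectorUnitary : Matrix ι ι ℝ)ᵀ := by
  have h := hA.spectral_theorem
  rw [Unitary.conjStarAlgAut_apply, Matrix.star_eq_conjTranspose,
    Matrix.conjTranspose_eq_transpose_of_trivial] at h
  simpa only [RCLike.ofReal_real_eq_id, Function.id_comp] using h

/-- Simultaneous congruence diagonalisation: for `A` positive definite and `B` symmetric (real)
there are `M` and `d` with `Mᵀ A M = 1` and `Mᵀ B M = diagonal d`. -/
theorem birGauss_exists_congruence {A B : Matrix ι ι ℝ} (hA : A.PosDef) (hB : B.IsHermitian) :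
    ∃ (M : Matrix ι ι ℝ) (d : ι → ℝ), Mᵀ * A * M = 1 ∧ Mᵀ * B * M = Matrix.diagonal d := by
  -- step 1: `A = U diag(a) Uᵀ`, `a > 0`; `P = U diag(1/√a)` gives `Pᵀ A P = 1`
  have hAh : A.IsHermitian := hA.1
  set U : Matrix ι ι ℝ := (hAh.eigenvectorUnitary : Matrix ι ι ℝ) with hU
  set a : ι → ℝ := hAh.eigenvalues with ha
  have hUU : Uᵀ * U = 1 := birGauss_transpose_mul_self _
  have hspec : A = U * Matrix.diagonal a * Uᵀ := birGauss_spectral hAh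
  have hapos : ∀ i, 0 < a i := fun i => hA.eigenvalues_pos i
  set s : ι → ℝ := fun i => (Real.sqrt (a i))⁻¹ with hs
  set P : Matrix ι ι ℝ := U * Matrix.diagonal s with hP
  have hPt : Pᵀ = Matrix.diagonal s * Uᵀ := by
    rw [hP, Matrix.transpose_mul, Matrix.diagonal_transpose]
  have hPAP : Pᵀ * A * P = 1 := by
    rw [hPt, hspec, hP]
    calc Matrix.diagonal s * Uᵀ * (U * Matrix.diagonal a * Uᵀ) * (U * Matrix.diagonal s)
        = Matrix.diagonal s * (Uᵀ * U) * Matrix.diagonal a * (Uᵀ * U) * Matrix.diagonal s := by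
          simp only [Matrix.mul_assoc]
      _ = Matrix.diagonal (fun i => s i * a i * s i) := by
          rw [hUU, Matrix.mul_one, Matrix.mul_one, Matrix.diagonal_mul_diagonal,
            Matrix.diagonal_mul_diagonal]
      _ = 1 := by
          rw [← Matrix.diagonal_one]
          congr 1
          ext i
          have hsa : 0 < Real.sqrt (a i) := Real.sqrt_pos.2 (hapos i)
          have : Real.sqrt (a i) * Real.sqrt (a i) = a i := Real.mul_self_sqrt (hapos i).le
          simp only [hs]
          field_simp
          linarith
  -- step 2: diagonalise `C = Pᵀ B P`
  set C : Matrix ι ι ℝ := Pᵀ * B * P with hC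
  have hCh : C.IsHermitian := by
    have h := Matrix.isHermitian_conjTranspose_mul_mul P hB
    rw [Matrix.conjTranspose_eq_transpose_of_trivial] at h
    exact h
  set V : Matrix ι ι ℝ := (hCh.eigenvectorUnitary : Matrix ι ι ℝ) with hV
  set d : ι → ℝ := hCh.eigenvalues with hd
  have hVV : Vᵀ * V = 1 := birGauss_transpose_mul_self _
  have hCspec : C = V * Matrix.diagonal d * Vᵀ := birGauss_spectral hCh
  refine ⟨P * V, d, ?_, ?_⟩
  · rw [Matrix.transpose_mul]
    calc Vᵀ * Pᵀ * A * (P * V) = Vᵀ * (Pᵀ * A * P) * V := by simp only [Matrix.mul_assoc]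
      _ = 1 := by rw [hPAP, Matrix.mul_one, hVV]
  · rw [Matrix.transpose_mul]
    calc Vᵀ * Pᵀ * B * (P * V) = Vᵀ * (Pᵀ * B * P) * V := by simp only [Matrix.mul_assoc]
      _ = Vᵀ * (V * Matrix.diagonal d * Vᵀ) * V := by rw [← hC, hCspec]
      _ = (Vᵀ * V) * Matrix.diagonal d * (Vᵀ * V) := by simp only [Matrix.mul_assoc]
      _ = Matrix.diagonal d := by rw [hVV, Matrix.one_mul, Matrix.mul_one]

/-- `Mᵀ A M = 1` forces `det M ≠ 0`. -/
theorem birGauss_det_ne_zero {A M : Matrix ι ι ℝ} (h : Mᵀ * A * M = 1) : M.det ≠ 0 := by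
  intro h0
  have := congrArg Matrix.det h
  rw [Matrix.det_mul, Matrix.det_mul, Matrix.det_transpose, h0, Matrix.det_one] at this
  simp at this

/-- Linear change of variables in `ℝ^ι`: `∫ F = |det M| ∫ F (M w) dw` for `det M ≠ 0`. -/
theorem birGauss_integral_comp_mulVec {M : Matrix ι ι ℝ} (hM : M.det ≠ 0)
    {F : (ι → ℝ) → ℂ} (hF : Continuous F) :
    (∫ u : ι → ℝ, F u) = |M.det| * ∫ w : ι → ℝ, F (M *ᵥ w) := by
  have hmap := Real.map_matrix_volume_pi_eq_smul_volume_pi hM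
  have hmeas : AEMeasurable (Matrix.toLin' M) (volume : Measure (ι → ℝ)) :=
    (LinearMap.continuous_of_finiteDimensional _).measurable.aemeasurable
  have h1 : (∫ w : ι → ℝ, F (M *ᵥ w)) = ∫ u, F u ∂(Measure.map (Matrix.toLin' M) volume) := by
    rw [integral_map hmeas hF.aestronglyMeasurable]
    rfl
  rw [h1, hmap, integral_smul_measure, ENNReal.toReal_ofReal (abs_nonneg _), abs_inv,
    Complex.real_smul, Complex.ofReal_inv, ← mul_assoc]
  have hdet : ((|M.det| : ℝ) : ℂ) ≠ 0 := by exact_mod_cast (abs_pos.2 hM).ne'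
  rw [mul_inv_cancel₀ hdet, one_mul]

/-- The one-dimensional complex Gaussian integral `∫ exp (−(1 + i d) x²/2) dx` is non-zero. -/
theorem birGauss_integral_one_dim_ne_zero (d : ℝ) :
    (∫ x : ℝ, Complex.exp (-((1 + Complex.I * d) / 2) * (x : ℂ) ^ 2)) ≠ 0 := by
  have hb : 0 < (((1 : ℂ) + Complex.I * d) / 2).re := by simp
  rw [integral_gaussian_complex hb, Ne, Complex.cpow_eq_zero_iff, not_and_or]
  left
  refine div_ne_zero (by exact_mod_cast Real.pi_ne_zero) ?_
  intro h0
  have := congrArg Complex.re h0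
  simp at this

omit [DecidableEq ι] in
/-- Real and imaginary parts of the complex quadratic form at a real vector. -/
theorem birGauss_form_re_im (Q : Matrix ι ι ℂ) (u : ι → ℝ) :
    (∑ i, ∑ j, Q i j * u i * u j)
      = ((u ⬝ᵥ ((Matrix.of fun i j => (Q i j).re) *ᵥ u) : ℝ) : ℂ)
        + Complex.I * ((u ⬝ᵥ ((Matrix.of fun i j => (Q i j).im) *ᵥ u) : ℝ) : ℂ) := by
  simp only [dotProduct, Matrix.mulVec, Matrix.of_apply, Finset.mul_sum,
    Complex.ofReal_sum, Complex.ofReal_mul, ← Finset.sum_add_distrib]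
  refine Finset.sum_congr rfl fun i _ => Finset.sum_congr rfl fun j _ => ?_
  have hQ : Q i j = ((Q i j).re : ℂ) + ((Q i j).im : ℂ) * Complex.I := (Complex.re_add_im _).symm
  rw [hQ]
  simp only [Complex.add_re, Complex.ofReal_re, Complex.mul_re, Complex.I_re, Complex.ofReal_im,
    Complex.I_im, Complex.add_im, Complex.mul_im, mul_zero, sub_zero, add_zero,
    mul_one, zero_add]
  ring

/-- **Non-vanishing of the complex Gaussian integral.**  For a symmetric complex matrix `Q`
whose quadratic form has positive definite real part on real vectors,
`∫_{ℝ^ι} exp (−½ Σ_{ij} Q_{ij} u_i u_j) du ≠ 0`. -/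
theorem birGauss_integral_ne_zero (Q : Matrix ι ι ℂ) (hQ : Q.IsSymm)
    (hpos : ∀ u : ι → ℝ, u ≠ 0 → 0 < (∑ i, ∑ j, Q i j * u i * u j).re) :
    (∫ u : ι → ℝ, Complex.exp (-(1 / 2 : ℂ) * ∑ i, ∑ j, Q i j * u i * u j)) ≠ 0 := by
  set A : Matrix ι ι ℝ := Matrix.of fun i j => (Q i j).re with hAdef
  set B : Matrix ι ι ℝ := Matrix.of fun i j => (Q i j).im with hBdef
  have hQsym : ∀ i j, Q j i = Q i j := fun i j => by
    simpa using congrFun (congrFun hQ i) j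
  have hform : ∀ u : ι → ℝ, (∑ i, ∑ j, Q i j * u i * u j)
      = ((u ⬝ᵥ (A *ᵥ u) : ℝ) : ℂ) + Complex.I * ((u ⬝ᵥ (B *ᵥ u) : ℝ) : ℂ) :=
    fun u => birGauss_form_re_im Q u
  have hre : ∀ u : ι → ℝ, (∑ i, ∑ j, Q i j * u i * u j).re = u ⬝ᵥ (A *ᵥ u) := fun u => by
    rw [hform]; simp
  -- `A` is positive definite, `B` symmetric
  have hAh : A.IsHermitian := by
    ext i j
    simp [A, Matrix.conjTranspose_apply, hQsym i j]
  have hBh : B.IsHermitian := by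
    ext i j
    simp [B, Matrix.conjTranspose_apply, hQsym i j]
  have hA : A.PosDef := by
    refine Matrix.PosDef.of_dotProduct_mulVec_pos hAh fun x hx => ?_
    have := hpos x hx
    rw [hre] at this
    simpa using this
  obtain ⟨M, d, hMA, hMB⟩ := birGauss_exists_congruence hA hBh
  have hdet : M.det ≠ 0 := birGauss_det_ne_zero hMA
  -- change variables `u = M w`
  have hcont : Continuous fun u : ι → ℝ =>
      Complex.exp (-(1 / 2 : ℂ) * ∑ i, ∑ j, Q i j * u i * u j) := by fun_prop
  rw [birGauss_integral_comp_mulVec hdet hcont]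
  refine mul_ne_zero (by exact_mod_cast (abs_pos.2 hdet).ne') ?_
  -- the transformed integrand is a product of one-dimensional Gaussians
  have hprod : ∀ w : ι → ℝ, Complex.exp (-(1 / 2 : ℂ) * ∑ i, ∑ j, Q i j * (M *ᵥ w) i * (M *ᵥ w) j)
      = ∏ i, Complex.exp (-((1 + Complex.I * d i) / 2) * ((w i : ℝ) : ℂ) ^ 2) := by
    intro w
    rw [hform (M *ᵥ w), birGauss_form_congr A M w, birGauss_form_congr B M w, hMA, hMB,
      Matrix.one_mulVec, ← Complex.exp_sum]
    congr 1
    simp only [dotProduct, Matrix.mulVec_diagonal, Complex.ofReal_sum, Complex.ofReal_mul,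
      Finset.mul_sum, ← Finset.sum_add_distrib, neg_mul]
    refine Finset.sum_congr rfl fun i _ => ?_
    ring
  simp_rw [hprod]
  rw [integral_fintype_prod_volume_eq_prod
    (f := fun i (x : ℝ) => Complex.exp (-((1 + Complex.I * d i) / 2) * (x : ℂ) ^ 2))]
  exact Finset.prod_ne_zero_iff.2 fun i _ => birGauss_integral_one_dim_ne_zero (d i)

end Gauss

end Summit.HubbardSuperconductivity.HubbardSuperconductivity.Theorems
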